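import Mathlib
import Summits.ValiantsHypothesis.ValiantsHypothesis.Theorems.NewtonUnitEquationsDissociatedUniformQuasiPoly

/-!
# Crux `NewtonUnitEquations.DissociatedUniform` (stmt-ValiantsHypothesis-5905), line `greedy-basis-shadow` —
# stub `stub_torusCrossNovelty` (torus frames: the demotion of a greedy word is span-novel among the lighter
# admissible demotions)

Setting: a frame `A : Fin m → Finset ℕ²` with coefficient polynomials `f i j`, the chart height
`h b = ε · Xf b + λ · Yf b`, a reference word `τ` with letters in the alphabet (`hτA`) and a word `a` that is
lex-greedy for `h` (`a ∈ QuasiPoly.gE (piFinset A) (col f) h`: `col f a` is not in the span of the columns of the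
strictly higher box words).  A DEMOTION is a pair `d = (j', l')` (coordinate, letter); its ratio vector is
`ψ d = (coeff l' (f i j') / coeff (τ j') (f i j'))_i` and its weight is `wt d = lh (τ j') - lh l'` for the letter
height `lh l = ε · l 0 + λ · l 1`.  On a TORUS frame (`htorus`: no coefficient of an alphabet letter vanishes) the
ratio vector of the demotion `(j, a j)` is not in the span of the ratio vectors of the demotions `d' = (j', l')`
with `l' ∈ A j'`, `wt d' < wt (j, a j)` and (`j' = j` or `a j' = τ j'`).

Proof.  Put `a' := update a j (τ j)` (coordinate `j` reset to `τ`).  Heights are additive over letters, so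
`h a' = h a + wt (j, a j)`, and splitting off the factor at `j` of the Khatri–Rao product gives
`col f a = col f a' * ψ (j, a j)` (pointwise product; `coeff (τ j) (f i j) ≠ 0` by torus).  For an admissible
`d' = (j', l')` one has `a' j' = τ j'`, so the word `b := update a' j' l'` lies in the box, has height
`h b = h a' - wt d' > h a`, and `col f b = col f a' * ψ d'`.  Hence the linear map "multiply pointwise by
`col f a'`" sends `ψ (j, a j)` to `col f a` and `ψ d'` to the column of a strictly higher box word; a relation
`ψ (j, a j) ∈ span (ψ '' S)` would put `col f a` in the span of the higher columns, contradicting greediness.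
(The deviation hypothesis `a j ≠ τ j` only serves to read off `a' j' = τ j'` in the case `a j' = τ j'`.)
[folklore]
-/

open scoped BigOperators

-- Sub = Summit single-conjunct layout: the duplicated namespace component is mandated by the tree.
set_option linter.dupNamespace false

namespace Summit.ValiantsHypothesis.ValiantsHypothesis.Theorems.NewtonUnitEquationsDissociatedUniform

/-- Splitting off the factor at the updated coordinate: for a coordinatewise family `g`, the product of
`g x (word x)` over the coordinates of the updated word `update c j₀ l₀`, times the old factor `g j₀ (c j₀)`, is the
new factor `g j₀ l₀` times the product for `c`. -/
@[to_additive /-- Splitting off the summand at the updated coordinate: for a coordinatewise family `g`, the sum of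
`g x (word x)` over the coordinates of the updated word `update c j₀ l₀`, plus the old summand `g j₀ (c j₀)`, is the
new summand `g j₀ l₀` plus the sum for `c`. -/]
private theorem prod_update_mul {m : ℕ} {M : Type*} [CommMonoid M] (g : Fin m → (Fin 2 →₀ ℕ) → M)
    (c : Fin m → (Fin 2 →₀ ℕ)) (j₀ : Fin m) (l₀ : Fin 2 →₀ ℕ) :
    (∏ x, g x (Function.update c j₀ l₀ x)) * g j₀ (c j₀) = g j₀ l₀ * ∏ x, g x (c x) := by
  rw [← Finset.mul_prod_erase Finset.univ (fun x => g x (Function.update c j₀ l₀ x)) (Finset.mem_univ j₀),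
    ← Finset.mul_prod_erase Finset.univ (fun x => g x (c x)) (Finset.mem_univ j₀), Function.update_self]
  have he : ∏ x ∈ Finset.univ.erase j₀, g x (Function.update c j₀ l₀ x) = ∏ x ∈ Finset.univ.erase j₀, g x (c x) :=
    Finset.prod_congr rfl fun x hx => by rw [Function.update_of_ne (Finset.ne_of_mem_erase hx)]
  rw [he, mul_right_comm, mul_assoc]

/-- **Torus cross novelty** (registered stub `stub_torusCrossNovelty` of line `greedy-basis-shadow`).  On a torus
frame, for a word `a` that is lex-greedy for the chart height `b ↦ ε · Xf b + λ · Yf b` and a coordinate `j`, the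
ratio vector `(coeff (a j) (f i j) / coeff (τ j) (f i j))_i` of the demotion `(j, a j)` is not in the span of the ratio
vectors of the admissible demotions `(j', l')` (`l' ∈ A j'`, `l' ≠ τ j'`, strictly smaller weight, and `j' = j` or
`a j' = τ j'`): pointwise multiplication by the column of the reset word `update a j (τ j)` turns such a relation into
a relation expressing `col f a` through columns of strictly higher box words. [folklore] -/
theorem stub_torusCrossNovelty (k m : ℕ) (A : Fin m → Finset (Fin 2 →₀ ℕ))
    (f : Fin k → Fin m → MvPolynomial (Fin 2) ℂ) (ε lam : ℝ) (τ a : Fin m → (Fin 2 →₀ ℕ)) (j : Fin m)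
    (htorus : ∀ i j, ∀ l ∈ A j, (f i j).coeff l ≠ 0) (hτA : ∀ j, τ j ∈ A j)
    (ha : a ∈ QuasiPoly.gE (Fintype.piFinset A) (QuasiPoly.col f)
      (fun b : Fin m → (Fin 2 →₀ ℕ) => ε * QuasiPoly.Xf b + lam * QuasiPoly.Yf b))
    (hj : a j ≠ τ j) :
    (fun i : Fin k => (f i j).coeff (a j) / (f i j).coeff (τ j)) ∉
      Submodule.span ℂ ((fun d : Fin m × (Fin 2 →₀ ℕ) => fun i : Fin k => (f i d.1).coeff d.2 / (f i d.1).coeff (τ d.1)) ''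
        {d' : Fin m × (Fin 2 →₀ ℕ) | d'.2 ∈ A d'.1 ∧ d'.2 ≠ τ d'.1 ∧
          (ε * ((τ d'.1 0 : ℕ) : ℝ) + lam * ((τ d'.1 1 : ℕ) : ℝ)) - (ε * ((d'.2 0 : ℕ) : ℝ) + lam * ((d'.2 1 : ℕ) : ℝ)) <
            (ε * ((τ j 0 : ℕ) : ℝ) + lam * ((τ j 1 : ℕ) : ℝ)) - (ε * ((a j 0 : ℕ) : ℝ) + lam * ((a j 1 : ℕ) : ℝ)) ∧
          (d'.1 = j ∨ a d'.1 = τ d'.1)}) := by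
  intro hmem
  obtain ⟨haA, hnot⟩ := ha
  apply hnot
  -- the chart height is additive over the letters of a word
  have hadd : ∀ b : Fin m → (Fin 2 →₀ ℕ), ε * QuasiPoly.Xf b + lam * QuasiPoly.Yf b
      = ∑ x, (ε * ((b x 0 : ℕ) : ℝ) + lam * ((b x 1 : ℕ) : ℝ)) := by
    intro b
    simp only [QuasiPoly.Xf, QuasiPoly.Yf, Finsupp.coe_finsetSum, Finset.sum_apply, Nat.cast_sum,
      Finset.mul_sum, Finset.sum_add_distrib]
  -- height of an updated word
  have hHupd : ∀ (c : Fin m → (Fin 2 →₀ ℕ)) (j₀ : Fin m) (l₀ : Fin 2 →₀ ℕ),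
      (ε * QuasiPoly.Xf (Function.update c j₀ l₀) + lam * QuasiPoly.Yf (Function.update c j₀ l₀))
        + (ε * ((c j₀ 0 : ℕ) : ℝ) + lam * ((c j₀ 1 : ℕ) : ℝ))
        = (ε * ((l₀ 0 : ℕ) : ℝ) + lam * ((l₀ 1 : ℕ) : ℝ)) + (ε * QuasiPoly.Xf c + lam * QuasiPoly.Yf c) := by
    intro c j₀ l₀
    rw [hadd, hadd]
    exact sum_update_add (fun _ l => ε * ((l 0 : ℕ) : ℝ) + lam * ((l 1 : ℕ) : ℝ)) c j₀ l₀
  -- column of an updated word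
  have hcolupd : ∀ (c : Fin m → (Fin 2 →₀ ℕ)) (j₀ : Fin m) (l₀ : Fin 2 →₀ ℕ) (i : Fin k),
      QuasiPoly.col f (Function.update c j₀ l₀) i * (f i j₀).coeff (c j₀)
        = (f i j₀).coeff l₀ * QuasiPoly.col f c i :=
    fun c j₀ l₀ i => prod_update_mul (fun x l => (f i x).coeff l) c j₀ l₀
  -- updating a box word by an alphabet letter stays in the box
  have hupdA : ∀ c : Fin m → (Fin 2 →₀ ℕ), c ∈ Fintype.piFinset A →
      ∀ (j₀ : Fin m) (l₀ : Fin 2 →₀ ℕ), l₀ ∈ A j₀ → Function.update c j₀ l₀ ∈ Fintype.piFinset A := by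
    intro c hc j₀ l₀ hl₀
    rw [Fintype.mem_piFinset] at hc ⊢
    intro x
    rcases eq_or_ne x j₀ with rfl | hx
    · rw [Function.update_self]; exact hl₀
    · rw [Function.update_of_ne hx]; exact hc x
  -- the reset word `a'` : coordinate `j` reset to `τ j`
  obtain ⟨a', ha'⟩ : ∃ a' : Fin m → (Fin 2 →₀ ℕ), a' = Function.update a j (τ j) := ⟨_, rfl⟩
  have ha'A : a' ∈ Fintype.piFinset A := by rw [ha']; exact hupdA a haA j (τ j) (hτA j)
  have ha'j : a' j = τ j := by rw [ha', Function.update_self]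
  have haa' : Function.update a' j (a j) = a := by rw [ha', Function.update_idem, Function.update_eq_self]
  -- `col f a = col f a' * ψ (j, a j)`
  have hcola : QuasiPoly.col f a' * (fun i : Fin k => (f i j).coeff (a j) / (f i j).coeff (τ j))
      = QuasiPoly.col f a := by
    funext i
    have h := hcolupd a' j (a j) i
    rw [haa', ha'j] at h
    show QuasiPoly.col f a' i * ((f i j).coeff (a j) / (f i j).coeff (τ j)) = QuasiPoly.col f a i
    rw [mul_div_assoc', div_eq_iff (htorus i j (τ j) (hτA j))]
    linear_combination -h
  -- push the relation through "multiply pointwise by `col f a'`"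
  have himg := Submodule.apply_mem_span_image_of_mem_span (LinearMap.mulLeft ℂ (QuasiPoly.col f a')) hmem
  rw [LinearMap.mulLeft_apply, hcola, ← Set.image_comp] at himg
  refine Submodule.span_mono ?_ himg
  rintro _ ⟨d', ⟨hl'A, -, hwt, hcase⟩, rfl⟩
  -- the admissible demotion `d' = (j', l')` acts on a coordinate where `a'` carries the letter `τ j'`
  have ha'j' : a' d'.1 = τ d'.1 := by
    rcases hcase with h | h
    · rw [h]; exact ha'j
    · have hne : d'.1 ≠ j := by
        intro h'
        rw [h'] at h
        exact hj h
      rw [ha', Function.update_of_ne hne]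
      exact h
  refine ⟨Function.update a' d'.1 d'.2, ⟨hupdA a' ha'A d'.1 d'.2 hl'A, ?_⟩, ?_⟩
  · -- the demoted reset word is strictly higher than `a`
    have h1 := hHupd a j (τ j)
    have h2 := hHupd a' d'.1 d'.2
    rw [← ha'] at h1
    rw [ha'j'] at h2
    show ε * QuasiPoly.Xf a + lam * QuasiPoly.Yf a
      < ε * QuasiPoly.Xf (Function.update a' d'.1 d'.2) + lam * QuasiPoly.Yf (Function.update a' d'.1 d'.2)
    linarith
  · -- and its column is `col f a' * ψ d'`
    funext i
    have h := hcolupd a' d'.1 d'.2 i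
    rw [ha'j'] at h
    show QuasiPoly.col f (Function.update a' d'.1 d'.2) i
      = QuasiPoly.col f a' i * ((f i d'.1).coeff d'.2 / (f i d'.1).coeff (τ d'.1))
    rw [mul_div_assoc', eq_div_iff (htorus i d'.1 (τ d'.1) (hτA d'.1))]
    linear_combination h

end Summit.ValiantsHypothesis.ValiantsHypothesis.Theorems.NewtonUnitEquationsDissociatedUniform
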